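import Summits.QuantumFields.YangMills.Theorems.BalabanUVNodesN15PerCubeGreenCovariantClose
import Summits.QuantumFields.YangMills.Theorems.BalabanUVNodesN15PerCubeGreenSopStairLetters
import Summits.QuantumFields.YangMills.Theorems.BalabanUVNodesN15TwoSpacingGluingSopLocality
import HarnessLib

/-!
# N15 = NE2, road (c) — PROGRAMME (PC), towards (PC-B): THE SITE COARSE KIT — `Q′G′²Q′ᵀ(U) − Q′G′²Q′ᵀ(𝟙)` for a `U(m)` field (3.35)-small in the TRIVIAL gauge near and in Bałaban's
# per-cube class far: `mulVecLin (cSop (cvT e U) a) − mulVecLin (cSop 𝟙 a) ≤ B·(r_V(1+|J⊕J|) + R_N + σ + (L^m)⁻¹ + e^{−δd_Z(y)})·e^{−δd}` on the coarse coloured scalars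
# (dag-n15-c g27, n15-c∕298b)

Cell `pub-ymgap`, seat `pub-ymgap-dag-n15-c` (generation g27; R134 (a), s1; HUMAN RULING D-0062).  `bears_on: R4∕N15 · K3⁸ SpineGivenEndpointR13SepCoPHV (stmt-QuantumFields-27366)`;
filed `--kind proof --supports stmt-QuantumFields-27366 --as helper` — COUNT-NEUTRAL.  0 `def`, 0 `sorry`.  Imports n15-c∕296 `…PerCubeGreenCovariantClose`
(`hasMaj_cGreen_sub_cGreen_one_of_reg335`; through it 266 `hasMaj_cGreen_of_reg335Box`, r06 `Reg335Cube`, `reg335Cube_gaugeTr_one`, `cvT_one`), n15-c∕297 `…TwoSpacingGluingSopLocality`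
(`hasMaj_sop_sub_sop`), n15-c∕298a∕298b-letters `…PerCubeGreenSopLetters`, `…PerCubeGreenSopStairLetters` (staircase letters, diagonal kernels, `Q′(T) − Q′(𝟙)` with a site-dependent
letter), n15-c∕202∕205 `hasMaj_csavg(_transpose)`, n15-c∕262's cover geometry (`scChi_lift_eq_one_of_near_bbox`, `blockOf_mem_cubeBlocks_of_inner_ne_zero`, `sum_hcube_sq`,
`abs_cenRep_lt_one_of_hcube_ne_zero`).  Nothing in the tree is modified.

WHY ((PC-B), [B9] (3.95)–(3.96) p.411).  The per-cube expansion of `(Q′G′²Q′ᵀ)⁻¹(U)` with FLAT local models `S(𝟙)` leaves, at cube `□`, the defect `M_ψ S(𝟙)⁻¹M_ψ(S(V_□) − S(𝟙))M_{h_□}`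
(`V_□ = U^{w_□}`, small in the trivial gauge on the doubled walk cube); this file IS the estimate of `S(V) − S(𝟙)` with the OUTPUT weight `e^{−δd_Z(y)}` (`Z ⊇` the far cubes' regions):
small where `y` is away from `Z`, i.e. near `□`, up to the data's own size `r_V, R_N, σ = (1 + r_VL^{−k})^{(d+1)L^k} − 1` and the partition letter `(L^m)⁻¹` — NO volume factor.
HOW: `Q′(𝟙)`, `Q′(V)ᵀ` block-diagonal with letter `|ι| + 1` (the staircase transports are orthogonal); `G′(V), G′(𝟙) ≤ B₆e^{−δd}` (266; the near cubes are in the class through the trivial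
datum `⟨1, A⟩`, the flat field through `reg335Cube_gaugeTr_one`); `G′(V) − G′(𝟙)` by 296; `Q′(V) − Q′(𝟙)` block-diagonal with the letter `σ` on blocks covered by a near cut box (every site
of the block carries the datum: n15-c∕298b-letters) and `|ι| + 1` on the others — those lie in a FAR cube (`Σ_kh_k² = 1` ⟹ some `h_k ≠ 0` ⟹ `χ_k = 1` ⟹ the block is in `□_k ⊆ Z`), where
`d_Z = 0`; then 297 with rates `δ₀ = min(δ₁∕64, δ₆∕16)`, `m = min(δ₀∕8, 3δ₁∕128)` and an explicit final constant.

HONEST FRAMING ∕ LIMITS.  MODEL carriers (n15-c∕262's cover of the doubled unit torus); no operator of record estimated; [B9] cited for SHAPES ∕ MECHANISM.  NE2⁺ NOT PRINTED, NOT proved;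
N15 of record untouched; K3⁸ OPEN; counts UNMOVED.  Restate-immune (no Theses import).
-/

noncomputable section

open scoped BigOperators Matrix Matrix.Norms.L2Operator

namespace Summit.QuantumFields.YangMills.BalabanUVNodes.N15.Gluing

open Real
open Literature.MathematicalPhysics.QuantumFieldTheory.Balaban1983to89
open Literature.MathematicalPhysics.QuantumFieldTheory.Balaban1983to89.B5Prop11Plancherel (Tor fine unitVec)
open Literature.MathematicalPhysics.QuantumFieldTheory.Balaban1983to89.B11SectG (BlockNorm HasMaj RowSum hasMaj_zero)
open Literature.MathematicalPhysics.QuantumFieldTheory.Balaban1983to89.B6RandomWalk (Triangle254)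
open Literature.MathematicalPhysics.QuantumFieldTheory.Balaban1983to89.B6Prop26Gluing (mulOp)
open Literature.MathematicalPhysics.QuantumFieldTheory.Balaban1983to89.B6UnitTorusCarrier (unitTorusGeo triangle254_unitTorusGeo rowSum_unitTorusGeo unitTorusGeo_dist_nonneg unitTorusGeo_dist_self)
open Literature.MathematicalPhysics.QuantumFieldTheory.Balaban1983to89.B9Eq335RegularityClasses (Reg335Cube)
open Literature.MathematicalPhysics.QuantumFieldTheory.Balaban1983to89.B9Eq3117Current (gaugeTr gaugeTr_apply)
open Literature.MathematicalPhysics.QuantumFieldTheory.Balaban1983to89.B9Eq39Adjoint (covD fluct)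
open Literature.MathematicalPhysics.QuantumFieldTheory.Balaban1983to89.B9BackgroundsKLevelV1 (fluct_zero)
open Summit.QuantumFields.YangMills.BalabanUVNodes.N15.CovLandau (claplA cGreen cSop csavg hasMaj_csavg hasMaj_csavg_transpose hasMaj_csavg_sub_at hasMaj_csavg_sub_transpose_at mulVecLin_sub')
open Summit.QuantumFields.YangMills.BalabanUVNodes.N15.CovAvg (cvaStair cvaStair_one)
open Summit.QuantumFields.YangMills.BalabanUVNodes.N15.BackgroundModel (kappa_ofBlocks)
open Summit.QuantumFields.YangMills.BalabanUVNodes.N15.DefectKernel (kingBlockOf_bpt)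
open Literature.MathematicalPhysics.QuantumFieldTheory.Balaban1983to89.B5Block118 (bpt)
open Literature.MathematicalPhysics.QuantumFieldTheory.Balaban1983to89.B9Eq335PureGaugeInClassAtLettersY (reg335Cube_gaugeTr_one)
open Literature.MathematicalPhysics.QuantumFieldTheory.King1986 (aK aK_pos aK_le)
open Literature.MathematicalPhysics.QuantumFieldTheory.King1986.Torus (blockOf)
open Literature.Barriers.QuantumFields (traceForm)
open Summit.QuantumFields.YangMills.BalabanUVNodes.N15.BackgroundLayer (covLapM tCoefA tCoefC)
open Summit.QuantumFields.YangMills.BalabanUVNodes.N15.VectorPiece (bshiftEquiv bshiftEquiv_apply)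
open Summit.QuantumFields.YangMills.BalabanUVNodes.N15.MatrixSpecies (mmulOp coordMat basisConst liftEquiv liftBlk)
open Summit.QuantumFields.YangMills.BalabanUVNodes.N15.TwoGrid (chiCube cubeBlocks)
open Summit.QuantumFields.YangMills.BalabanUVNodes.N15.CurvedSpecies (gaugePair uN_exists_gauge_cutCoefLetters_of_reg335Cube uN_localCoefLetters_of_gauge335)

variable {d : ℕ}

section Green

variable {L : ℕ} [NeZero L]

set_option maxHeartbeats 400000 in

/-- ★★★ **THE SITE COARSE KIT: `Q′G′²Q′ᵀ(U) − Q′G′²Q′ᵀ(𝟙)` IS SMALL NEAR AND DECAYS**, for a `U(m)` field (3.35)-small in the TRIVIAL gauge on the boxes of the cubes not in `Far` and in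
Bałaban's per-cube class on the far boxes, `Z ⊇` the far cubes' regions, `d_Z ≥ 0` a Lipschitz minorant of the distance to `Z`: on the coarse coloured scalars
`mulVecLin (cSop (cvT e U) a_K) − mulVecLin (cSop 𝟙 a_K) ≤ B·(r_V(1 + |J ⊕ J|) + R_N(r_V) + σ(r_V) + (L^m)⁻¹ + e^{−δd_Z(y)})·e^{−δ|y−y′|_T}`, `σ = (1 + r_VL^{−k})^{(d+1)L^k} − 1`,
`R_N = a_K|ι|(|ι|σ² + 2σ)` — the input estimate of the (3.95) defect, with NO volume factor.  MODEL carriers; the SHAPE of [B9] (3.95)–(3.96) ∕ Cor. 3.8, NOT the printed statements.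
[cite: Balaban1985BackgroundPropagators, (3.95)–(3.96) p.411, Cor. 3.8 p.410, (3.25) p.394, (3.34)–(3.35) p.396 (shape ∕ mechanism); Balaban1984PropagatorsI, (1.20) p.20] -/
theorem hasMaj_cSop_sub_cSop_one_of_reg335 (hL : Odd L ∧ 1 < L) (hL7 : 7 ≤ L) {a₀ : ℝ} (ha₀ : 0 < a₀) (ι : Type) [Fintype ι] [DecidableEq ι] :
    ∃ δ w₀ R₀ B : ℝ, 0 < δ ∧ 0 < R₀ ∧ 0 < B ∧
      ∀ (mv kk : ℕ), 1 ≤ kk → w₀ ≤ ((L ^ mv : ℕ) : ℝ) →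
      ∀ {mm : Type} [Fintype mm] [DecidableEq mm] [Nonempty mm] (e : Matrix mm mm ℂ ≃L[ℝ] (ι → ℝ)), (∀ A B : Matrix mm mm ℂ, traceForm A B = e A ⬝ᵥ e B) →
      ∀ (Far : (Fin (d + 1) → ZMod (2 * L)) → Prop) [DecidablePred Far] (Z : Set (Tor (cvM d L mv kk hL))) (dZ : Tor (cvM d L mv kk hL) → ℝ),
        (∀ y z, z ∈ Z → dZ y ≤ (unitTorusGeo L kk (cvM d L mv kk hL)).dist y z) → (∀ y, 0 ≤ dZ y) → (∀ y z, dZ y ≤ (unitTorusGeo L kk (cvM d L mv kk hL)).dist y z + dZ z) →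
        (∀ k, Far k → cvSk d L mv kk hL k ⊆ Z) →
      ∀ (U : Fin (d + 1) → ScX d L mv kk hL → (Matrix mm mm ℂ)ˣ), (∀ μ x, (U μ x : Matrix mm mm ℂ) ∈ Matrix.unitaryGroup mm ℂ) →
      ∀ (ξ C : ℝ), 0 < ξ → 0 < C →
        (∀ k, Far k → Reg335Cube (scShift d L mv kk hL) U ((((L ^ kk : ℕ) : ℝ))⁻¹) {x : ScX d L mv kk hL | blockOf (L ^ kk) (cvM d L mv kk hL) x ∈ cubeBlocks (cvM d L mv kk hL) (coverCorner (cvM d L mv kk hL) (L ^ mv) L (2 * L ^ mv + 1) k) (6 * L ^ mv + 3)} ξ C) →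
        (∀ k, ¬Far k → ∃ A : Fin (d + 1) → ScX d L mv kk hL → Matrix mm mm ℂ, (∀ μ, ∀ z ∈ {x : ScX d L mv kk hL | blockOf (L ^ kk) (cvM d L mv kk hL) x ∈ cubeBlocks (cvM d L mv kk hL) (coverCorner (cvM d L mv kk hL) (L ^ mv) L (2 * L ^ mv + 1) k) (6 * L ^ mv + 3)}, gaugeTr (scShift d L mv kk hL) (fun _ => (1 : (Matrix mm mm ℂ)ˣ)) U μ z = fluct ((((L ^ kk : ℕ) : ℝ))⁻¹) A μ z) ∧
          (∀ μ, ∀ z ∈ {x : ScX d L mv kk hL | blockOf (L ^ kk) (cvM d L mv kk hL) x ∈ cubeBlocks (cvM d L mv kk hL) (coverCorner (cvM d L mv kk hL) (L ^ mv) L (2 * L ^ mv + 1) k) (6 * L ^ mv + 3)}, ‖A μ z‖ < C * ξ⁻¹) ∧ (∀ μ ν, ∀ z ∈ {x : ScX d L mv kk hL | blockOf (L ^ kk) (cvM d L mv kk hL) x ∈ cubeBlocks (cvM d L mv kk hL) (coverCorner (cvM d L mv kk hL) (L ^ mv) L (2 * L ^ mv + 1) k) (6 * L ^ mv + 3)},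 ‖((↑((((L ^ kk : ℕ) : ℝ))⁻¹) : ℂ)⁻¹) • covD (scShift d L mv kk hL) (fun _ _ => (1 : (Matrix mm mm ℂ)ˣ)) μ (A ν) z‖ < C * (ξ ^ 2)⁻¹)) →
      ∀ (rV : ℝ), 0 ≤ rV →
        Fintype.card ι * (@basisConst ι _ (Matrix mm mm ℂ) Matrix.frobeniusNormedAddCommGroup Matrix.frobeniusNormedSpace e * (2 * Real.sqrt (Fintype.card mm)) * (Real.sqrt (Fintype.card mm) * ((C / ξ) * Real.exp (((((L ^ kk : ℕ) : ℝ))⁻¹) * (C / ξ))))) ≤ rV →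
        Fintype.card ι * (Fintype.card (Fin (d + 1)) * (Fintype.card ι * (@basisConst ι _ (Matrix mm mm ℂ) Matrix.frobeniusNormedAddCommGroup Matrix.frobeniusNormedSpace e * (2 * Real.sqrt (Fintype.card mm)) * (Real.sqrt (Fintype.card mm) * ((C / ξ) * Real.exp (((((L ^ kk : ℕ) : ℝ))⁻¹) * (C / ξ))))) ^ 2 + @basisConst ι _ (Matrix mm mm ℂ) Matrix.frobeniusNormedAddCommGroup Matrix.frobeniusNormedSpace e * (2 * Real.sqrt (Fintype.card mm)) * (Real.sqrt (Fintype.card mm) * ((C / ξ ^ 2) * Real.exp (((((L ^ kk : ℕ) : ℝ))⁻¹) * (C / ξ)))))) ≤ rV →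
        rV * (1 + Fintype.card (Fin (d + 1) ⊕ Fin (d + 1))) + a₀ * (Fintype.card ι * (Fintype.card ι * ((1 + rV * ((((L ^ kk : ℕ) : ℝ))⁻¹)) ^ ((d + 1) * L ^ kk) - 1) ^ 2 + 2 * ((1 + rV * ((((L ^ kk : ℕ) : ℝ))⁻¹)) ^ ((d + 1) * L ^ kk) - 1))) ≤ R₀ →
        HasMaj (BlockNorm.ofBlocks (unitTorusGeo L kk (cvM d L mv kk hL)) (liftBlk (fun y : Tor (cvM d L mv kk hL) => y) ι))
            (BlockNorm.ofBlocks (unitTorusGeo L kk (cvM d L mv kk hL)) (liftBlk (fun y : Tor (cvM d L mv kk hL) => y) ι))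
            (Matrix.mulVecLin (cSop (cvM d L mv kk hL) (L ^ kk) (cvT e (fun μ x => (U μ x : Matrix mm mm ℂ))) (aK a₀ (L : ℝ) kk * (((L ^ kk : ℕ) : ℝ)) ^ (d + 1))) -
              Matrix.mulVecLin (cSop (cvM d L mv kk hL) (L ^ kk) (fun (_ : Fin (d + 1)) (_ : ScX d L mv kk hL) => (1 : Matrix ι ι ℝ)) (aK a₀ (L : ℝ) kk * (((L ^ kk : ℕ) : ℝ)) ^ (d + 1))))
          (fun y y' => B * (rV * (1 + Fintype.card (Fin (d + 1) ⊕ Fin (d + 1))) + aK a₀ (L : ℝ) kk * (Fintype.card ι * (Fintype.card ι * ((1 + rV * ((((L ^ kk : ℕ) : ℝ))⁻¹)) ^ ((d + 1) * L ^ kk) - 1) ^ 2 + 2 * ((1 + rV * ((((L ^ kk : ℕ) : ℝ))⁻¹)) ^ ((d + 1) * L ^ kk) - 1))) +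
              ((1 + rV * ((((L ^ kk : ℕ) : ℝ))⁻¹)) ^ ((d + 1) * L ^ kk) - 1) + (((L ^ mv : ℕ) : ℝ))⁻¹ + Real.exp (-(δ * dZ y))) * Real.exp (-(δ * (unitTorusGeo L kk (cvM d L mv kk hL)).dist y y'))) := by
  classical
  obtain ⟨δ₁, w₁, R₁, B₁, hδ₁, hR₁, hB₁, H₁⟩ := hasMaj_cGreen_sub_cGreen_one_of_reg335 (d := d) hL hL7 ha₀ ι
  obtain ⟨δ₆, w₆, R₆, B₆, hδ₆, hR₆, hB₆, H₆⟩ := hasMaj_cGreen_of_reg335Box (d := d) hL hL7 ha₀ ι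
  -- rates: common decay `δ₀`, weight∕row-sum `m`, three convolution steps
  set δ₀ : ℝ := min (δ₁ / 64) (δ₆ / 16) with hδ₀def
  have hδ₀ : 0 < δ₀ := lt_min (by positivity) (by positivity)
  have hδ₀₁ : δ₀ ≤ δ₁ / 64 := min_le_left _ _
  have hδ₀₆ : δ₀ ≤ δ₆ / 16 := min_le_right _ _
  set m : ℝ := min (δ₀ / 8) (3 * δ₁ / 128) with hmdef
  have hm : 0 < m := lt_min (by positivity) (by positivity)
  have hm8 : m ≤ δ₀ / 8 := min_le_left _ _
  have hmc : m ≤ 3 * δ₁ / 128 := min_le_right _ _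
  set cr : ℝ := B4Sect5Proof.latticeConst (d + 1) m with hcrdef
  have hcr0 : 0 ≤ cr := B4Sect5Proof.latticeConst_nonneg (d + 1) hm.le
  set τ : ℝ := (Fintype.card ι : ℝ) + 1 with hτdef
  have hτ0 : 0 ≤ τ := by positivity
  -- the four constants of n15-c∕297 (all block norms here have `κ = 1`)
  set K₁ : ℝ := 1 * 1 * (1 * B₆ * (1 * B₆ * τ * cr) * cr) * cr with hK₁
  set K₂ : ℝ := 1 * τ * (1 * B₁ * (1 * B₆ * τ * cr) * cr) * cr with hK₂
  set K₃ : ℝ := 1 * τ * (1 * B₆ * (1 * B₁ * τ * cr) * cr) * cr with hK₃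
  set K₄ : ℝ := 1 * τ * (1 * B₆ * (1 * B₆ * 1 * cr) * cr) * cr with hK₄
  set Bout : ℝ := (K₁ + K₄) * (τ + 1) + (K₂ + K₃) + 1 with hBout
  refine ⟨m, max (max w₁ w₆) 2, min R₁ R₆, Bout, hm, lt_min hR₁ hR₆, by positivity, fun mv kk hk hw₀ => ?_⟩
  intro mm _ _ _ e he Far _ Z dZ hdZ hdZ0 hdZl hZ U hU ξ C hξ hC hfar hnear rV hrV hrA hrC hRle
  have hw₁ : w₁ ≤ ((L ^ mv : ℕ) : ℝ) := ((le_max_left _ _).trans (le_max_left _ _)).trans hw₀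
  have hw₆ : w₆ ≤ ((L ^ mv : ℕ) : ℝ) := ((le_max_right _ _).trans (le_max_left _ _)).trans hw₀
  have hW2 : 2 ≤ L ^ mv := by have h := (le_max_right (max w₁ w₆) 2).trans hw₀; exact_mod_cast h
  have hRle₁ : rV * (1 + Fintype.card (Fin (d + 1) ⊕ Fin (d + 1))) + a₀ * (Fintype.card ι * (Fintype.card ι * ((1 + rV * ((((L ^ kk : ℕ) : ℝ))⁻¹)) ^ ((d + 1) * L ^ kk) - 1) ^ 2 + 2 * ((1 + rV * ((((L ^ kk : ℕ) : ℝ))⁻¹)) ^ ((d + 1) * L ^ kk) - 1))) ≤ R₁ := hRle.trans (min_le_left _ _)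
  have hRle₆ : rV * (1 + Fintype.card (Fin (d + 1) ⊕ Fin (d + 1))) + a₀ * (Fintype.card ι * (Fintype.card ι * ((1 + rV * ((((L ^ kk : ℕ) : ℝ))⁻¹)) ^ ((d + 1) * L ^ kk) - 1) ^ 2 + 2 * ((1 + rV * ((((L ^ kk : ℕ) : ℝ))⁻¹)) ^ ((d + 1) * L ^ kk) - 1))) ≤ R₆ := hRle.trans (min_le_right _ _)
  have hU' : ∀ μ x, ((U μ x : Matrix mm mm ℂ))ᴴ * (U μ x : Matrix mm mm ℂ) = 1 := fun μ x => Matrix.mem_unitaryGroup_iff'.mp (hU μ x)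
  have hη : (0 : ℝ) < ((((L ^ kk : ℕ) : ℝ))⁻¹) := inv_pos.mpr (Nat.cast_pos.mpr (pow_pos (Nat.pos_of_ne_zero (NeZero.ne L)) kk))
  have hη1 : ((((L ^ kk : ℕ) : ℝ))⁻¹) ≤ 1 := inv_le_one_of_one_le₀ (by exact_mod_cast Nat.one_le_pow _ _ (Nat.pos_of_ne_zero (NeZero.ne L)))
  have hL1r : (1 : ℝ) < (L : ℝ) := by exact_mod_cast hL.2
  have ha' : 0 < (aK a₀ (L : ℝ) kk * (((L ^ kk : ℕ) : ℝ)) ^ (d + 1)) := mul_pos (aK_pos ha₀ hL1r hk) (by positivity)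
  -- geometry
  have htri : Triangle254 (unitTorusGeo L kk (cvM d L mv kk hL)) := triangle254_unitTorusGeo L kk _
  have hd : ∀ a b : Tor (cvM d L mv kk hL), 0 ≤ (unitTorusGeo L kk (cvM d L mv kk hL)).dist a b := unitTorusGeo_dist_nonneg L kk _
  have hd0 : ∀ y : Tor (cvM d L mv kk hL), (unitTorusGeo L kk (cvM d L mv kk hL)).dist y y = 0 := unitTorusGeo_dist_self L kk _
  have hrow : RowSum (unitTorusGeo L kk (cvM d L mv kk hL)) m cr := by rw [hcrdef]; exact rowSum_unitTorusGeo L kk _ hm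
  -- (3.35) on EVERY box for `U` (near: the trivial datum IS a class datum) and for the flat field
  have hone : ∀ z : ScX d L mv kk hL, ‖(((fun (_ : ScX d L mv kk hL) => (1 : (Matrix mm mm ℂ)ˣ)) z : (Matrix mm mm ℂ)ˣ) : Matrix mm mm ℂ)‖ ≤ 1 ∧
      ‖((((fun (_ : ScX d L mv kk hL) => (1 : (Matrix mm mm ℂ)ˣ)) z)⁻¹ : (Matrix mm mm ℂ)ˣ) : Matrix mm mm ℂ)‖ ≤ 1 :=
    fun z => by simp only [Units.val_one, inv_one]; exact ⟨norm_one.le, norm_one.le⟩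
  have h335 : ∀ k, Reg335Cube (scShift d L mv kk hL) U ((((L ^ kk : ℕ) : ℝ))⁻¹) {x : ScX d L mv kk hL | blockOf (L ^ kk) (cvM d L mv kk hL) x ∈ cubeBlocks (cvM d L mv kk hL) (coverCorner (cvM d L mv kk hL) (L ^ mv) L (2 * L ^ mv + 1) k) (6 * L ^ mv + 3)} ξ C := fun k => by
    by_cases hk : Far k
    · exact hfar k hk
    · obtain ⟨A, hg, hA, hD⟩ := hnear k hk
      exact ⟨fun _ => 1, A, fun z _ => hone z, hg, hA, hD⟩
  have h335one : ∀ k, Reg335Cube (scShift d L mv kk hL) (fun (_ : Fin (d + 1)) (_ : ScX d L mv kk hL) => (1 : (Matrix mm mm ℂ)ˣ)) ((((L ^ kk : ℕ) : ℝ))⁻¹) {x : ScX d L mv kk hL | blockOf (L ^ kk) (cvM d L mv kk hL) x ∈ cubeBlocks (cvM d L mv kk hL) (coverCorner (cvM d L mv kk hL) (L ^ mv) L (2 * L ^ mv + 1) k) (6 * L ^ mv + 3)} ξ C := fun k => by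
    have h := reg335Cube_gaugeTr_one (scShift d L mv kk hL) (η := ((((L ^ kk : ℕ) : ℝ))⁻¹)) {x : ScX d L mv kk hL | blockOf (L ^ kk) (cvM d L mv kk hL) x ∈ cubeBlocks (cvM d L mv kk hL) (coverCorner (cvM d L mv kk hL) (L ^ mv) L (2 * L ^ mv + 1) k) (6 * L ^ mv + 3)} hξ hC (fun (_ : ScX d L mv kk hL) => (1 : (Matrix mm mm ℂ)ˣ)) (fun z _ => hone z)
    have hg : gaugeTr (scShift d L mv kk hL) (fun (_ : ScX d L mv kk hL) => (1 : (Matrix mm mm ℂ)ˣ)) (fun (_ : Fin (d + 1)) (_ : ScX d L mv kk hL) => (1 : (Matrix mm mm ℂ)ˣ)) =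
        fun (_ : Fin (d + 1)) (_ : ScX d L mv kk hL) => (1 : (Matrix mm mm ℂ)ˣ) := by
      funext μ x; rw [gaugeTr_apply, inv_one, mul_one, mul_one]
    rwa [hg] at h
  have h1U : ∀ (μ : Fin (d + 1)) (x : ScX d L mv kk hL), (((fun (_ : Fin (d + 1)) (_ : ScX d L mv kk hL) => (1 : (Matrix mm mm ℂ)ˣ)) μ x : (Matrix mm mm ℂ)ˣ) : Matrix mm mm ℂ) ∈ Matrix.unitaryGroup mm ℂ :=
    fun μ x => by simp only [Units.val_one]; exact Submonoid.one_mem _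
  -- the Green's function rows (n15-c∕266) for `U` and for the flat field, at the common rate
  have hrate : ∀ ⦃c ρ ρ' : ℝ⦄, 0 ≤ c → ρ' ≤ ρ → ∀ y y' : Tor (cvM d L mv kk hL), c * Real.exp (-(ρ * (unitTorusGeo L kk (cvM d L mv kk hL)).dist y y')) ≤ c * Real.exp (-(ρ' * (unitTorusGeo L kk (cvM d L mv kk hL)).dist y y')) :=
    fun c ρ ρ' hc hρ y y' => mul_le_mul_of_nonneg_left (Real.exp_le_exp.mpr (by nlinarith only [hd y y', hρ])) hc
  have hG : HasMaj (ScNorm d L mv kk hL ι) (ScNorm d L mv kk hL ι) (Matrix.mulVecLin (cGreen (cvM d L mv kk hL) (L ^ kk) (cvT e (fun μ x => (U μ x : Matrix mm mm ℂ))) (aK a₀ (L : ℝ) kk * (((L ^ kk : ℕ) : ℝ)) ^ (d + 1))))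
      (fun y y' => B₆ * Real.exp (-(δ₀ * (unitTorusGeo L kk (cvM d L mv kk hL)).dist y y'))) :=
    (H₆ mv kk hk hw₆ e he U hU ξ C hξ hC.le h335 rV hrV hrA hrC hRle₆).mono (hrate hB₆.le hδ₀₆)
  have hG₁ : HasMaj (ScNorm d L mv kk hL ι) (ScNorm d L mv kk hL ι) (Matrix.mulVecLin (cGreen (cvM d L mv kk hL) (L ^ kk) (fun (_ : Fin (d + 1)) (_ : ScX d L mv kk hL) => (1 : Matrix ι ι ℝ)) (aK a₀ (L : ℝ) kk * (((L ^ kk : ℕ) : ℝ)) ^ (d + 1))))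
      (fun y y' => B₆ * Real.exp (-(δ₀ * (unitTorusGeo L kk (cvM d L mv kk hL)).dist y y'))) := by
    have h := (H₆ mv kk hk hw₆ e he (fun (_ : Fin (d + 1)) (_ : ScX d L mv kk hL) => (1 : (Matrix mm mm ℂ)ˣ)) h1U ξ C hξ hC.le h335one rV hrV hrA hrC hRle₆).mono
      (hrate hB₆.le hδ₀₆)
    rwa [show (fun μ x => (((fun (_ : Fin (d + 1)) (_ : ScX d L mv kk hL) => (1 : (Matrix mm mm ℂ)ˣ)) μ x : (Matrix mm mm ℂ)ˣ) : Matrix mm mm ℂ)) = fun _ _ => (1 : Matrix mm mm ℂ) from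
      funext fun _ => funext fun _ => Units.val_one, cvT_one e] at h
  -- the closeness of the Green's functions (n15-c∕296), in n15-c∕297's currency
  have hGG : HasMaj (ScNorm d L mv kk hL ι) (ScNorm d L mv kk hL ι)
      (Matrix.mulVecLin (cGreen (cvM d L mv kk hL) (L ^ kk) (cvT e (fun μ x => (U μ x : Matrix mm mm ℂ))) (aK a₀ (L : ℝ) kk * (((L ^ kk : ℕ) : ℝ)) ^ (d + 1))) - Matrix.mulVecLin (cGreen (cvM d L mv kk hL) (L ^ kk) (fun (_ : Fin (d + 1)) (_ : ScX d L mv kk hL) => (1 : Matrix ι ι ℝ)) (aK a₀ (L : ℝ) kk * (((L ^ kk : ℕ) : ℝ)) ^ (d + 1))))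
      (fun y y' => ((rV * (1 + Fintype.card (Fin (d + 1) ⊕ Fin (d + 1))) + aK a₀ (L : ℝ) kk * (Fintype.card ι * (Fintype.card ι * ((1 + rV * ((((L ^ kk : ℕ) : ℝ))⁻¹)) ^ ((d + 1) * L ^ kk) - 1) ^ 2 + 2 * ((1 + rV * ((((L ^ kk : ℕ) : ℝ))⁻¹)) ^ ((d + 1) * L ^ kk) - 1))) + (((L ^ mv : ℕ) : ℝ))⁻¹) + 1 * Real.exp (-((3 * δ₁ / 128) * dZ y))) * (B₁ * Real.exp (-(δ₀ * (unitTorusGeo L kk (cvM d L mv kk hL)).dist y y')))) := by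
    refine (H₁ mv kk hk hw₁ e he Far Z dZ hdZ hdZ0 hZ U hU ξ C hξ hC hfar hnear rV hrV hrA hrC hRle₁).mono fun y y' => ?_
    have hexp : Real.exp (-(δ₁ / 64 * (unitTorusGeo L kk (cvM d L mv kk hL)).dist y y')) ≤ Real.exp (-(δ₀ * (unitTorusGeo L kk (cvM d L mv kk hL)).dist y y')) := Real.exp_le_exp.mpr (by nlinarith only [hd y y', hδ₀₁])
    have hw0 : 0 ≤ rV * (1 + Fintype.card (Fin (d + 1) ⊕ Fin (d + 1))) + aK a₀ (L : ℝ) kk * (Fintype.card ι * (Fintype.card ι * ((1 + rV * ((((L ^ kk : ℕ) : ℝ))⁻¹)) ^ ((d + 1) * L ^ kk) - 1) ^ 2 + 2 * ((1 + rV * ((((L ^ kk : ℕ) : ℝ))⁻¹)) ^ ((d + 1) * L ^ kk) - 1))) + (((L ^ mv : ℕ) : ℝ))⁻¹ + Real.exp (-(3 * δ₁ / 128 * dZ y)) := by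
      have hS : 0 ≤ ((1 + rV * ((((L ^ kk : ℕ) : ℝ))⁻¹)) ^ ((d + 1) * L ^ kk) - 1) := by
        have := one_le_pow₀ (M₀ := ℝ) (a := 1 + rV * ((((L ^ kk : ℕ) : ℝ))⁻¹)) (le_add_of_nonneg_right (mul_nonneg hrV hη.le)) (n := (d + 1) * L ^ kk); linarith only [this]
      have haK := aK_pos ha₀ hL1r hk
      exact add_nonneg (add_nonneg (add_nonneg (mul_nonneg hrV (add_nonneg zero_le_one (Nat.cast_nonneg _)))
        (mul_nonneg haK.le (mul_nonneg (Nat.cast_nonneg _) (add_nonneg (mul_nonneg (Nat.cast_nonneg _) (sq_nonneg _)) (mul_nonneg zero_le_two hS)))))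
        (inv_nonneg.2 (Nat.cast_nonneg _))) (Real.exp_nonneg _)
    calc B₁ * (rV * (1 + Fintype.card (Fin (d + 1) ⊕ Fin (d + 1))) + aK a₀ (L : ℝ) kk * (Fintype.card ι * (Fintype.card ι * ((1 + rV * ((((L ^ kk : ℕ) : ℝ))⁻¹)) ^ ((d + 1) * L ^ kk) - 1) ^ 2 + 2 * ((1 + rV * ((((L ^ kk : ℕ) : ℝ))⁻¹)) ^ ((d + 1) * L ^ kk) - 1))) + (((L ^ mv : ℕ) : ℝ))⁻¹ + Real.exp (-(3 * δ₁ / 128 * dZ y))) * Real.exp (-(δ₁ / 64 * (unitTorusGeo L kk (cvM d L mv kk hL)).dist y y'))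
        ≤ B₁ * (rV * (1 + Fintype.card (Fin (d + 1) ⊕ Fin (d + 1))) + aK a₀ (L : ℝ) kk * (Fintype.card ι * (Fintype.card ι * ((1 + rV * ((((L ^ kk : ℕ) : ℝ))⁻¹)) ^ ((d + 1) * L ^ kk) - 1) ^ 2 + 2 * ((1 + rV * ((((L ^ kk : ℕ) : ℝ))⁻¹)) ^ ((d + 1) * L ^ kk) - 1))) + (((L ^ mv : ℕ) : ℝ))⁻¹ + Real.exp (-(3 * δ₁ / 128 * dZ y))) * Real.exp (-(δ₀ * (unitTorusGeo L kk (cvM d L mv kk hL)).dist y y')) :=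
          mul_le_mul_of_nonneg_left hexp (mul_nonneg hB₁.le hw0)
      _ = _ := by ring
  -- the block averagings: `Q′(𝟙)` and `Q′(T)ᵀ` (diagonal rows, letter `τ = |ι| + 1`)
  have hnpos : (0 : ℝ) < ((L ^ kk : ℕ) : ℝ) ^ (d + 1) := by positivity
  have hninv : ((((L ^ kk : ℕ) : ℝ)) ^ (d + 1))⁻¹ ≤ 1 := inv_le_one_of_one_le₀ (one_le_pow₀ (by exact_mod_cast Nat.one_le_pow _ _ (Nat.pos_of_ne_zero (NeZero.ne L))))
  have hQ₁ : HasMaj (ScNorm d L mv kk hL ι) (BlockNorm.ofBlocks (unitTorusGeo L kk (cvM d L mv kk hL)) (liftBlk (fun y : Tor (cvM d L mv kk hL) => y) ι)) (Matrix.mulVecLin (csavg (cvM d L mv kk hL) (L ^ kk) (fun (_ : Fin (d + 1)) (_ : ScX d L mv kk hL) => (1 : Matrix ι ι ℝ))))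
      (fun y y' => τ * Real.exp (-(δ₀ * (unitTorusGeo L kk (cvM d L mv kk hL)).dist y y'))) := by
    have h := hasMaj_csavg (cvM d L mv kk hL) (L ^ kk) L kk (fun (_ : Fin (d + 1)) (_ : ScX d L mv kk hL) => (1 : Matrix ι ι ℝ)) (τ := τ) hτ0 fun y a i => by
      rw [cvaStair_one]
      calc ∑ j, |(1 : Matrix ι ι ℝ) i j| = 1 := by simp only [Matrix.one_apply, apply_ite abs, abs_one, abs_zero, Finset.sum_ite_eq, Finset.mem_univ, if_true]
        _ ≤ τ := by rw [hτdef]; linarith only [Nat.cast_nonneg (α := ℝ) (Fintype.card ι)]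
    exact HasMaj.diag_const_exp δ₀ hd0 hτ0 h
  have hR : HasMaj (BlockNorm.ofBlocks (unitTorusGeo L kk (cvM d L mv kk hL)) (liftBlk (fun y : Tor (cvM d L mv kk hL) => y) ι)) (ScNorm d L mv kk hL ι) (Matrix.mulVecLin (csavg (cvM d L mv kk hL) (L ^ kk) (cvT e (fun μ x => (U μ x : Matrix mm mm ℂ))))ᵀ)
      (fun y y' => τ * Real.exp (-(δ₀ * (unitTorusGeo L kk (cvM d L mv kk hL)).dist y y'))) := by
    have h := hasMaj_csavg_transpose (cvM d L mv kk hL) (L ^ kk) L kk (cvT e (fun μ x => (U μ x : Matrix mm mm ℂ))) (τ := Fintype.card ι) (Nat.cast_nonneg _)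
      fun y a i => cols_cvaStair_cvT_le (cvM d L mv kk hL) (L ^ kk) e he hU' y a 0 i
    have h2 : HasMaj (BlockNorm.ofBlocks (unitTorusGeo L kk (cvM d L mv kk hL)) (liftBlk (fun y : Tor (cvM d L mv kk hL) => y) ι)) (ScNorm d L mv kk hL ι) (Matrix.mulVecLin (csavg (cvM d L mv kk hL) (L ^ kk) (cvT e (fun μ x => (U μ x : Matrix mm mm ℂ))))ᵀ)
        (fun w w' => if w = w' then τ else 0) := h.mono fun w w' => by
      split_ifs
      · calc ((((L ^ kk : ℕ) : ℝ)) ^ (d + 1))⁻¹ * (Fintype.card ι : ℝ) ≤ 1 * (Fintype.card ι : ℝ) := mul_le_mul_of_nonneg_right hninv (Nat.cast_nonneg _)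
          _ ≤ τ := by rw [hτdef]; linarith only []
      · exact le_rfl
    exact HasMaj.diag_const_exp δ₀ hd0 hτ0 h2
  -- the cover's windows (n15-c∕262's geometry): `h_k(x) ≠ 0 ⟹ χ_k(x) = 1`, `χ_k(x) ≠ 0 ⟹ B(x) ∈ □_k`
  have hM : ∀ ν, cvM d L mv kk hL ν = 2 * L * L ^ mv := MP_succ_eq L mv kk hL
  have hw : 0 < L ^ mv := by omega
  have hlo : (2 : ℝ) * ((L ^ mv : ℕ) : ℝ) ≤ ((2 * L ^ mv : ℕ) : ℝ) := by push_cast; exact le_rfl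
  have hhi : ((2 * L ^ mv : ℕ) : ℝ) + ((L ^ mv : ℕ) : ℝ) + (2 + 1) * ((L ^ mv : ℕ) : ℝ) + 1 ≤ ((6 * L ^ mv + 1 : ℕ) : ℝ) := by push_cast; linarith only []
  have hS6 : 6 * L ^ mv + 1 ≤ 2 * L * L ^ mv := by
    have h7 : 7 * L ^ mv ≤ L * L ^ mv := Nat.mul_le_mul_right _ hL7
    have e : 2 * L * L ^ mv = 2 * (L * L ^ mv) := by ring
    rw [e]; omega
  have hm₁ : 2 * L ^ mv ≤ coverMargin L mv := two_mul_le_coverMargin hL7 mv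
  have hfitI : coverMargin L mv - 2 * L ^ mv + (6 * L ^ mv + 1) ≤ L * L ^ mv := coverMargin_inner_fit hL7 hW2
  have hS0 : L * L ^ mv ≤ 2 * L * L ^ mv := by rw [mul_assoc]; omega
  have hK2 : 2 ≤ 2 * L := by omega
  have hwin : ∀ (k : Fin (d + 1) → ZMod (2 * L)) (x : ScX d L mv kk hL), scH d L mv kk hL k x ≠ 0 → scChi d L mv kk hL k x = 1 := fun k x hx =>
    scChi_lift_eq_one_of_near_bbox (ι := Unit) 2 hM hw hlo hhi hS6 0 k (x, ())
      ⟨(x, ()), Or.inl rfl, fun ν => (abs_cenRep_lt_one_of_hcube_ne_zero (K := 2 * L) (ξ := scXi d L mv kk hL) hx ν).trans (by norm_num)⟩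
  have hcover : ∀ x : ScX d L mv kk hL, ∃ k : Fin (d + 1) → ZMod (2 * L), scH d L mv kk hL k x ≠ 0 := fun x => by
    by_contra h
    push Not at h
    have h1 := sum_hcube_sq (2 * L) (scXi d L mv kk hL) hK2 x
    rw [Finset.sum_eq_zero (fun k _ => by rw [show hcube (2 * L) (scXi d L mv kk hL) k x = 0 from h k, zero_pow two_ne_zero])] at h1
    exact zero_ne_one h1
  have hblk : ∀ (k : Fin (d + 1) → ZMod (2 * L)) (x x' : ScX d L mv kk hL), blockOf (L ^ kk) (cvM d L mv kk hL) x' = blockOf (L ^ kk) (cvM d L mv kk hL) x →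
      scChi d L mv kk hL k x' = scChi d L mv kk hL k x := fun k x x' h => by
    simp only [scChi, chiCube, h]
  -- the block letter of the staircase of `T = cvT e U` minus `1`: near blocks by the datum, far blocks in `Z`
  have hηrV : 0 ≤ rV * ((((L ^ kk : ℕ) : ℝ))⁻¹) := mul_nonneg hrV hη.le
  have hSIG0 : 0 ≤ ((1 + rV * ((((L ^ kk : ℕ) : ℝ))⁻¹)) ^ ((d + 1) * L ^ kk) - 1) := by
    have := one_le_pow₀ (M₀ := ℝ) (a := 1 + rV * ((((L ^ kk : ℕ) : ℝ))⁻¹)) (le_add_of_nonneg_right hηrV) (n := (d + 1) * L ^ kk); linarith only [this]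
  have hletter : ∀ (y : Tor (cvM d L mv kk hL)) (a : Fin (d + 1) → Fin (L ^ kk)),
      (∀ i, ∑ j, |(cvaStair (cvM d L mv kk hL) (L ^ kk) (fun μ b => cvT e (fun μ x => (U μ x : Matrix mm mm ℂ)) μ b.1) y a 0 - cvaStair (cvM d L mv kk hL) (L ^ kk) (fun μ b => (fun (_ : Fin (d + 1)) (_ : ScX d L mv kk hL) => (1 : Matrix ι ι ℝ)) μ b.1) y a 0) i j| ≤ (if dZ y = 0 then ((1 + rV * ((((L ^ kk : ℕ) : ℝ))⁻¹)) ^ ((d + 1) * L ^ kk) - 1) + ((Fintype.card ι : ℝ) + 1) else ((1 + rV * ((((L ^ kk : ℕ) : ℝ))⁻¹)) ^ ((d + 1) * L ^ kk) - 1))) ∧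
      (∀ j, ∑ i, |(cvaStair (cvM d L mv kk hL) (L ^ kk) (fun μ b => cvT e (fun μ x => (U μ x : Matrix mm mm ℂ)) μ b.1) y a 0 - cvaStair (cvM d L mv kk hL) (L ^ kk) (fun μ b => (fun (_ : Fin (d + 1)) (_ : ScX d L mv kk hL) => (1 : Matrix ι ι ℝ)) μ b.1) y a 0) i j| ≤ (if dZ y = 0 then ((1 + rV * ((((L ^ kk : ℕ) : ℝ))⁻¹)) ^ ((d + 1) * L ^ kk) - 1) + ((Fintype.card ι : ℝ) + 1) else ((1 + rV * ((((L ^ kk : ℕ) : ℝ))⁻¹)) ^ ((d + 1) * L ^ kk) - 1))) := fun y a => by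
    have hbx : blockOf (L ^ kk) (cvM d L mv kk hL) (bpt (L ^ kk) (cvM d L mv kk hL) y a) = y := kingBlockOf_bpt _ _ y a
    obtain ⟨k, hkx⟩ := hcover (bpt (L ^ kk) (cvM d L mv kk hL) y a)
    have hχ : scChi d L mv kk hL k (bpt (L ^ kk) (cvM d L mv kk hL) y a) ≠ 0 := by rw [hwin k _ hkx]; exact one_ne_zero
    by_cases hk : Far k
    · -- far: the block lies in `Z`, `d_Z(y) = 0`, and the crude letter `|ι| + 1`
      have hyZ : y ∈ Z := by
        have h := Finset.mem_coe.mpr (blockOf_mem_cubeBlocks_of_inner_ne_zero hM hm₁ hfitI hS0 hχ)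
        rw [hbx] at h
        exact hZ k hk h
      have hdy : dZ y = 0 := le_antisymm (by have := hdZ y y hyZ; rwa [hd0] at this) (hdZ0 y)
      rw [if_pos hdy]
      obtain ⟨hr, hc⟩ := rows_cols_cvaStair_cvT_sub_one_le ι e he hU' y a 0
      exact ⟨fun i => (hr i).trans (by linarith only [hSIG0]), fun j => (hc j).trans (by linarith only [hSIG0])⟩
    · -- near: every site of the block carries the trivial datum of cube `k`
      obtain ⟨A, hg, hA, hD⟩ := hnear k hk
      have hT : ∀ μ x', blockOf (L ^ kk) (cvM d L mv kk hL) x' = y →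
          (∀ i, ∑ j, |(cvT e (fun μ x => (U μ x : Matrix mm mm ℂ)) μ x' - 1) i j| ≤ rV * ((((L ^ kk : ℕ) : ℝ))⁻¹)) ∧ ∀ j, ∑ i, |(cvT e (fun μ x => (U μ x : Matrix mm mm ℂ)) μ x' - 1) i j| ≤ rV * ((((L ^ kk : ℕ) : ℝ))⁻¹) := fun μ x' hx' => by
        have hχ' : scChi d L mv kk hL k x' ≠ 0 := by rw [hblk k _ x' (hx'.trans hbx.symm)]; exact hχ
        have hQ := (scChi_ne_zero_nbhd hL hL7 mv kk k x' hχ').1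
        obtain ⟨hr, hc⟩ := rows_cols_cvT_sub_one_le_of_datum ι e (scShift d L mv kk hL) hU hη hg hA hD hQ μ
        have hle : Fintype.card ι * (@basisConst ι _ (Matrix mm mm ℂ) Matrix.frobeniusNormedAddCommGroup Matrix.frobeniusNormedSpace e * (2 * Real.sqrt (Fintype.card mm)) *
            (Real.sqrt (Fintype.card mm) * (((((L ^ kk : ℕ) : ℝ))⁻¹) * (C / ξ) * Real.exp (((((L ^ kk : ℕ) : ℝ))⁻¹) * (C / ξ))))) ≤ rV * ((((L ^ kk : ℕ) : ℝ))⁻¹) := by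
          have e1 : Fintype.card ι * (@basisConst ι _ (Matrix mm mm ℂ) Matrix.frobeniusNormedAddCommGroup Matrix.frobeniusNormedSpace e * (2 * Real.sqrt (Fintype.card mm)) *
              (Real.sqrt (Fintype.card mm) * (((((L ^ kk : ℕ) : ℝ))⁻¹) * (C / ξ) * Real.exp (((((L ^ kk : ℕ) : ℝ))⁻¹) * (C / ξ))))) =
              ((((L ^ kk : ℕ) : ℝ))⁻¹) * (Fintype.card ι * (@basisConst ι _ (Matrix mm mm ℂ) Matrix.frobeniusNormedAddCommGroup Matrix.frobeniusNormedSpace e * (2 * Real.sqrt (Fintype.card mm)) *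
                (Real.sqrt (Fintype.card mm) * ((C / ξ) * Real.exp (((((L ^ kk : ℕ) : ℝ))⁻¹) * (C / ξ)))))) := by ring
          rw [e1, mul_comm rV]
          exact mul_le_mul_of_nonneg_left hrA hη.le
        exact ⟨fun i => (hr i).trans hle, fun j => (hc j).trans hle⟩
      have h1 : cvaStair (cvM d L mv kk hL) (L ^ kk) (fun μ b => (fun (_ : Fin (d + 1)) (_ : ScX d L mv kk hL) => (1 : Matrix ι ι ℝ)) μ b.1) y a 0 = 1 := cvaStair_one _ _ y a 0
      have hrow := fun i => rows_cvaStair_sub_one_le_of_blockOf ι hηrV y (fun μ x' hx' i => ((hT μ x' hx').1 i)) a 0 i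
      have hcol := fun j => cols_cvaStair_sub_one_le_of_blockOf ι hηrV y (fun μ x' hx' j => ((hT μ x' hx').2 j)) a 0 j
      have hσle : ((1 + rV * ((((L ^ kk : ℕ) : ℝ))⁻¹)) ^ ((d + 1) * L ^ kk) - 1) ≤ (if dZ y = 0 then ((1 + rV * ((((L ^ kk : ℕ) : ℝ))⁻¹)) ^ ((d + 1) * L ^ kk) - 1) + ((Fintype.card ι : ℝ) + 1) else ((1 + rV * ((((L ^ kk : ℕ) : ℝ))⁻¹)) ^ ((d + 1) * L ^ kk) - 1)) := by
        split_ifs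
        · linarith only [Nat.cast_nonneg (α := ℝ) (Fintype.card ι)]
        · exact le_rfl
      rw [h1]
      exact ⟨fun i => (hrow i).trans hσle, fun j => (hcol j).trans hσle⟩
  have hσ0 : ∀ y : Tor (cvM d L mv kk hL), 0 ≤ (if dZ y = 0 then ((1 + rV * ((((L ^ kk : ℕ) : ℝ))⁻¹)) ^ ((d + 1) * L ^ kk) - 1) + ((Fintype.card ι : ℝ) + 1) else ((1 + rV * ((((L ^ kk : ℕ) : ℝ))⁻¹)) ^ ((d + 1) * L ^ kk) - 1)) := fun y => by
    split_ifs
    · positivity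
    · exact hSIG0
  have hσf : ∀ y : Tor (cvM d L mv kk hL), (if dZ y = 0 then ((1 + rV * ((((L ^ kk : ℕ) : ℝ))⁻¹)) ^ ((d + 1) * L ^ kk) - 1) + ((Fintype.card ι : ℝ) + 1) else ((1 + rV * ((((L ^ kk : ℕ) : ℝ))⁻¹)) ^ ((d + 1) * L ^ kk) - 1)) ≤
      (((1 + rV * ((((L ^ kk : ℕ) : ℝ))⁻¹)) ^ ((d + 1) * L ^ kk) - 1) + ((Fintype.card ι : ℝ) + 1) * Real.exp (-((3 * δ₁ / 128) * dZ y))) * 1 := fun y => by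
    split_ifs with h
    · rw [h, mul_zero, neg_zero, Real.exp_zero, mul_one, mul_one]
    · rw [mul_one]; exact le_add_of_nonneg_right (by positivity)
  have hQQ : HasMaj (ScNorm d L mv kk hL ι) (BlockNorm.ofBlocks (unitTorusGeo L kk (cvM d L mv kk hL)) (liftBlk (fun y : Tor (cvM d L mv kk hL) => y) ι))
      (Matrix.mulVecLin (csavg (cvM d L mv kk hL) (L ^ kk) (cvT e (fun μ x => (U μ x : Matrix mm mm ℂ)))) - Matrix.mulVecLin (csavg (cvM d L mv kk hL) (L ^ kk) (fun (_ : Fin (d + 1)) (_ : ScX d L mv kk hL) => (1 : Matrix ι ι ℝ))))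
      (fun y y' => (((1 + rV * ((((L ^ kk : ℕ) : ℝ))⁻¹)) ^ ((d + 1) * L ^ kk) - 1) + ((Fintype.card ι : ℝ) + 1) * Real.exp (-((3 * δ₁ / 128) * dZ y))) * (1 * Real.exp (-(δ₀ * (unitTorusGeo L kk (cvM d L mv kk hL)).dist y y')))) := by
    have h := hasMaj_csavg_sub_at (cvM d L mv kk hL) (L ^ kk) L kk (cvT e (fun μ x => (U μ x : Matrix mm mm ℂ))) hσ0 (fun y a i => (hletter y a).1 i)
    rw [mulVecLin_sub'] at h
    exact HasMaj.diag_weight_exp dZ δ₀ hd0 hSIG0 (by positivity) zero_le_one hσf h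
  have hRR : HasMaj (BlockNorm.ofBlocks (unitTorusGeo L kk (cvM d L mv kk hL)) (liftBlk (fun y : Tor (cvM d L mv kk hL) => y) ι)) (ScNorm d L mv kk hL ι)
      (Matrix.mulVecLin (csavg (cvM d L mv kk hL) (L ^ kk) (cvT e (fun μ x => (U μ x : Matrix mm mm ℂ))))ᵀ - Matrix.mulVecLin (csavg (cvM d L mv kk hL) (L ^ kk) (fun (_ : Fin (d + 1)) (_ : ScX d L mv kk hL) => (1 : Matrix ι ι ℝ)))ᵀ)
      (fun y y' => (((1 + rV * ((((L ^ kk : ℕ) : ℝ))⁻¹)) ^ ((d + 1) * L ^ kk) - 1) + ((Fintype.card ι : ℝ) + 1) * Real.exp (-((3 * δ₁ / 128) * dZ y))) * (1 * Real.exp (-(δ₀ * (unitTorusGeo L kk (cvM d L mv kk hL)).dist y y')))) := by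
    have h := hasMaj_csavg_sub_transpose_at (cvM d L mv kk hL) (L ^ kk) L kk (cvT e (fun μ x => (U μ x : Matrix mm mm ℂ))) hσ0 (fun y a j => (hletter y a).2 j)
    rw [Matrix.transpose_sub, mulVecLin_sub'] at h
    have h2 := h.mono fun w w' => show _ ≤ (if w = w' then (if dZ w = 0 then ((1 + rV * ((((L ^ kk : ℕ) : ℝ))⁻¹)) ^ ((d + 1) * L ^ kk) - 1) + ((Fintype.card ι : ℝ) + 1) else ((1 + rV * ((((L ^ kk : ℕ) : ℝ))⁻¹)) ^ ((d + 1) * L ^ kk) - 1)) else 0) by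
      by_cases hw : w = w'
      · rw [if_pos hw, if_pos hw]; exact mul_le_of_le_one_left (hσ0 w) hninv
      · rw [if_neg hw, if_neg hw]
    exact HasMaj.diag_weight_exp dZ δ₀ hd0 hSIG0 (by positivity) zero_le_one hσf h2
  -- n15-c∕297: the coarse kit
  have hsop := hasMaj_sop_sub_sop dZ htri hd hrow hm.le hcr0 hdZl hdZ0 (τ := τ) (B := B₆) (p := 1) (b := B₁) (sQ := ((1 + rV * ((((L ^ kk : ℕ) : ℝ))⁻¹)) ^ ((d + 1) * L ^ kk) - 1)) (fQ := (Fintype.card ι : ℝ) + 1)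
    (sG := rV * (1 + Fintype.card (Fin (d + 1) ⊕ Fin (d + 1))) + aK a₀ (L : ℝ) kk * (Fintype.card ι * (Fintype.card ι * ((1 + rV * ((((L ^ kk : ℕ) : ℝ))⁻¹)) ^ ((d + 1) * L ^ kk) - 1) ^ 2 + 2 * ((1 + rV * ((((L ^ kk : ℕ) : ℝ))⁻¹)) ^ ((d + 1) * L ^ kk) - 1))) + (((L ^ mv : ℕ) : ℝ))⁻¹) (fG := 1) (δ := δ₀) (c := 3 * δ₁ / 128) (m := m) (r₁ := δ₀ - 2 * m) (r₂ := δ₀ - 4 * m) (r₃ := δ₀ - 6 * m)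
    hτ0 hB₆.le zero_le_one hB₁.le hSIG0 (by positivity) ?_ zero_le_one hm.le hmc (by linarith only [hm8, hδ₀]) (by linarith only []) (by linarith only []) (by linarith only [])
    hQ₁ hR hG hG₁ hQQ hRR hGG
  swap
  · have := aK_pos ha₀ hL1r hk
    exact add_nonneg (add_nonneg (mul_nonneg hrV (add_nonneg zero_le_one (Nat.cast_nonneg _)))
      (mul_nonneg this.le (mul_nonneg (Nat.cast_nonneg _) (add_nonneg (mul_nonneg (Nat.cast_nonneg _) (sq_nonneg _)) (mul_nonneg zero_le_two hSIG0))))) (inv_nonneg.2 (Nat.cast_nonneg _))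
  -- `cSop = Q′G′G′Q′ᵀ` as compositions
  have hcS : ∀ T : Fin (d + 1) → ScX d L mv kk hL → Matrix ι ι ℝ, Matrix.mulVecLin (cSop (cvM d L mv kk hL) (L ^ kk) T (aK a₀ (L : ℝ) kk * (((L ^ kk : ℕ) : ℝ)) ^ (d + 1))) =
      Matrix.mulVecLin (csavg (cvM d L mv kk hL) (L ^ kk) T) ∘ₗ (Matrix.mulVecLin (cGreen (cvM d L mv kk hL) (L ^ kk) T (aK a₀ (L : ℝ) kk * (((L ^ kk : ℕ) : ℝ)) ^ (d + 1))) ∘ₗ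
        (Matrix.mulVecLin (cGreen (cvM d L mv kk hL) (L ^ kk) T (aK a₀ (L : ℝ) kk * (((L ^ kk : ℕ) : ℝ)) ^ (d + 1))) ∘ₗ Matrix.mulVecLin (csavg (cvM d L mv kk hL) (L ^ kk) T)ᵀ)) := fun T => by
    rw [cSop, Matrix.mulVecLin_mul, Matrix.mulVecLin_mul, Matrix.mulVecLin_mul]
    rfl
  rw [hcS, hcS]
  -- the final constant: the four weighted constants of n15-c∕297 against ONE
  have hc0 : (0 : ℝ) ≤ (Fintype.card ι : ℝ) := Nat.cast_nonneg _
  have hW0 : 0 ≤ (((L ^ mv : ℕ) : ℝ))⁻¹ := inv_nonneg.2 (Nat.cast_nonneg _)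
  have hRC0 : 0 ≤ rV * (1 + Fintype.card (Fin (d + 1) ⊕ Fin (d + 1))) := mul_nonneg hrV (add_nonneg zero_le_one (Nat.cast_nonneg _))
  have hRN0 : 0 ≤ aK a₀ (L : ℝ) kk * (Fintype.card ι * (Fintype.card ι * ((1 + rV * ((((L ^ kk : ℕ) : ℝ))⁻¹)) ^ ((d + 1) * L ^ kk) - 1) ^ 2 + 2 * ((1 + rV * ((((L ^ kk : ℕ) : ℝ))⁻¹)) ^ ((d + 1) * L ^ kk) - 1))) := by
    have := aK_pos ha₀ hL1r hk
    exact mul_nonneg this.le (mul_nonneg (Nat.cast_nonneg _) (add_nonneg (mul_nonneg (Nat.cast_nonneg _) (sq_nonneg _)) (mul_nonneg zero_le_two hSIG0)))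
  have hK₁0 : 0 ≤ K₁ := by rw [hK₁]; positivity
  have hK₂0 : 0 ≤ K₂ := by rw [hK₂]; positivity
  have hK₃0 : 0 ≤ K₃ := by rw [hK₃]; positivity
  have hK₄0 : 0 ≤ K₄ := by rw [hK₄]; positivity
  have hfin : ∀ (κ : ℝ) (y y' : Tor (cvM d L mv kk hL)), κ = 1 →
      ((((1 + rV * ((((L ^ kk : ℕ) : ℝ))⁻¹)) ^ ((d + 1) * L ^ kk) - 1) + ((Fintype.card ι : ℝ) + 1) * Real.exp (-(m * dZ y))) * (κ * 1 * (κ * B₆ * (κ * B₆ * τ * cr) * cr) * cr) +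
          (rV * (1 + Fintype.card (Fin (d + 1) ⊕ Fin (d + 1))) + aK a₀ (L : ℝ) kk * (Fintype.card ι * (Fintype.card ι * ((1 + rV * ((((L ^ kk : ℕ) : ℝ))⁻¹)) ^ ((d + 1) * L ^ kk) - 1) ^ 2 + 2 * ((1 + rV * ((((L ^ kk : ℕ) : ℝ))⁻¹)) ^ ((d + 1) * L ^ kk) - 1))) + (((L ^ mv : ℕ) : ℝ))⁻¹ + 1 * Real.exp (-(m * dZ y))) * (κ * τ * (κ * B₁ * (κ * B₆ * τ * cr) * cr) * cr) +
          (rV * (1 + Fintype.card (Fin (d + 1) ⊕ Fin (d + 1))) + aK a₀ (L : ℝ) kk * (Fintype.card ι * (Fintype.card ι * ((1 + rV * ((((L ^ kk : ℕ) : ℝ))⁻¹)) ^ ((d + 1) * L ^ kk) - 1) ^ 2 + 2 * ((1 + rV * ((((L ^ kk : ℕ) : ℝ))⁻¹)) ^ ((d + 1) * L ^ kk) - 1))) + (((L ^ mv : ℕ) : ℝ))⁻¹ + 1 * Real.exp (-(m * dZ y))) * (κ * τ * (κ * B₆ * (κ * B₁ * τ * cr) * cr) * cr) +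
          (((1 + rV * ((((L ^ kk : ℕ) : ℝ))⁻¹)) ^ ((d + 1) * L ^ kk) - 1) + ((Fintype.card ι : ℝ) + 1) * Real.exp (-(m * dZ y))) * (κ * τ * (κ * B₆ * (κ * B₆ * 1 * cr) * cr) * cr)) *
        Real.exp (-((δ₀ - 6 * m) * (unitTorusGeo L kk (cvM d L mv kk hL)).dist y y')) ≤
      Bout * (rV * (1 + Fintype.card (Fin (d + 1) ⊕ Fin (d + 1))) + aK a₀ (L : ℝ) kk * (Fintype.card ι * (Fintype.card ι * ((1 + rV * ((((L ^ kk : ℕ) : ℝ))⁻¹)) ^ ((d + 1) * L ^ kk) - 1) ^ 2 + 2 * ((1 + rV * ((((L ^ kk : ℕ) : ℝ))⁻¹)) ^ ((d + 1) * L ^ kk) - 1))) + ((1 + rV * ((((L ^ kk : ℕ) : ℝ))⁻¹)) ^ ((d + 1) * L ^ kk) - 1) + (((L ^ mv : ℕ) : ℝ))⁻¹ + Real.exp (-(m * dZ y))) * Real.exp (-(m * (unitTorusGeo L kk (cvM d L mv kk hL)).dist y y')) := by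
    rintro κ y y' rfl
    have ht0 : 0 ≤ Real.exp (-(m * dZ y)) := Real.exp_nonneg _
    have hexp : Real.exp (-((δ₀ - 6 * m) * (unitTorusGeo L kk (cvM d L mv kk hL)).dist y y')) ≤ Real.exp (-(m * (unitTorusGeo L kk (cvM d L mv kk hL)).dist y y')) := Real.exp_le_exp.mpr (by nlinarith only [hd y y', hm8, hδ₀])
    have hG0 : 0 ≤ rV * (1 + Fintype.card (Fin (d + 1) ⊕ Fin (d + 1))) + aK a₀ (L : ℝ) kk * (Fintype.card ι * (Fintype.card ι * ((1 + rV * ((((L ^ kk : ℕ) : ℝ))⁻¹)) ^ ((d + 1) * L ^ kk) - 1) ^ 2 + 2 * ((1 + rV * ((((L ^ kk : ℕ) : ℝ))⁻¹)) ^ ((d + 1) * L ^ kk) - 1))) + (((L ^ mv : ℕ) : ℝ))⁻¹ := add_nonneg (add_nonneg hRC0 hRN0) hW0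
    have hX0 : 0 ≤ ((1 + rV * ((((L ^ kk : ℕ) : ℝ))⁻¹)) ^ ((d + 1) * L ^ kk) - 1) + (rV * (1 + Fintype.card (Fin (d + 1) ⊕ Fin (d + 1))) + aK a₀ (L : ℝ) kk * (Fintype.card ι * (Fintype.card ι * ((1 + rV * ((((L ^ kk : ℕ) : ℝ))⁻¹)) ^ ((d + 1) * L ^ kk) - 1) ^ 2 + 2 * ((1 + rV * ((((L ^ kk : ℕ) : ℝ))⁻¹)) ^ ((d + 1) * L ^ kk) - 1))) + (((L ^ mv : ℕ) : ℝ))⁻¹) + Real.exp (-(m * dZ y)) := add_nonneg (add_nonneg hSIG0 hG0) ht0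
    have hK14 : 0 ≤ K₁ + K₄ := add_nonneg hK₁0 hK₄0
    have hK23 : 0 ≤ K₂ + K₃ := add_nonneg hK₂0 hK₃0
    have ha : ((1 + rV * ((((L ^ kk : ℕ) : ℝ))⁻¹)) ^ ((d + 1) * L ^ kk) - 1) + ((Fintype.card ι : ℝ) + 1) * Real.exp (-(m * dZ y)) ≤ ((Fintype.card ι : ℝ) + 2) * (((1 + rV * ((((L ^ kk : ℕ) : ℝ))⁻¹)) ^ ((d + 1) * L ^ kk) - 1) + (rV * (1 + Fintype.card (Fin (d + 1) ⊕ Fin (d + 1))) + aK a₀ (L : ℝ) kk * (Fintype.card ι * (Fintype.card ι * ((1 + rV * ((((L ^ kk : ℕ) : ℝ))⁻¹)) ^ ((d + 1) * L ^ kk) - 1) ^ 2 + 2 * ((1 + rV * ((((L ^ kk : ℕ) : ℝ))⁻¹)) ^ ((d + 1) * L ^ kk) - 1))) + (((L ^ mv : ℕ) : ℝ))⁻¹) + Real.exp (-(m * dZ y))) := by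
      nlinarith only [mul_nonneg hc0 hSIG0, mul_nonneg hc0 hG0, mul_nonneg hc0 ht0, hSIG0, hG0, ht0]
    have hb : rV * (1 + Fintype.card (Fin (d + 1) ⊕ Fin (d + 1))) + aK a₀ (L : ℝ) kk * (Fintype.card ι * (Fintype.card ι * ((1 + rV * ((((L ^ kk : ℕ) : ℝ))⁻¹)) ^ ((d + 1) * L ^ kk) - 1) ^ 2 + 2 * ((1 + rV * ((((L ^ kk : ℕ) : ℝ))⁻¹)) ^ ((d + 1) * L ^ kk) - 1))) + (((L ^ mv : ℕ) : ℝ))⁻¹ + 1 * Real.exp (-(m * dZ y)) ≤ ((1 + rV * ((((L ^ kk : ℕ) : ℝ))⁻¹)) ^ ((d + 1) * L ^ kk) - 1) + (rV * (1 + Fintype.card (Fin (d + 1) ⊕ Fin (d + 1))) + aK a₀ (L : ℝ) kk * (Fintype.card ι * (Fintype.card ι * ((1 + rV * ((((L ^ kk : ℕ) : ℝ))⁻¹)) ^ ((d + 1) * L ^ kk) - 1) ^ 2 + 2 * ((1 + rV * ((((L ^ kk : ℕ) : ℝ))⁻¹)) ^ ((d + 1) * L ^ kk) - 1))) + (((L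 ^ mv : ℕ) : ℝ))⁻¹) + Real.exp (-(m * dZ y)) := by linarith only [hSIG0]
    have hmid0 : 0 ≤ (K₁ + K₄) * (((Fintype.card ι : ℝ) + 2) * (((1 + rV * ((((L ^ kk : ℕ) : ℝ))⁻¹)) ^ ((d + 1) * L ^ kk) - 1) + (rV * (1 + Fintype.card (Fin (d + 1) ⊕ Fin (d + 1))) + aK a₀ (L : ℝ) kk * (Fintype.card ι * (Fintype.card ι * ((1 + rV * ((((L ^ kk : ℕ) : ℝ))⁻¹)) ^ ((d + 1) * L ^ kk) - 1) ^ 2 + 2 * ((1 + rV * ((((L ^ kk : ℕ) : ℝ))⁻¹)) ^ ((d + 1) * L ^ kk) - 1))) + (((L ^ mv : ℕ) : ℝ))⁻¹) + Real.exp (-(m * dZ y)))) + (K₂ + K₃) * (((1 + rV * ((((L ^ kk : ℕ) : ℝ))⁻¹)) ^ ((d + 1) * L ^ kk) - 1) + (rV * (1 + Fintype.card (Fin (d + 1) ⊕ Fin (d + 1))) + aK a₀ (L : ℝ) kk * (Fintype.card ι * (Fintype.card ι * ((1 + rV * ((((L ^ kk : ℕ) : ℝ))⁻¹)) ^ ((d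 + 1) * L ^ kk) - 1) ^ 2 + 2 * ((1 + rV * ((((L ^ kk : ℕ) : ℝ))⁻¹)) ^ ((d + 1) * L ^ kk) - 1))) + (((L ^ mv : ℕ) : ℝ))⁻¹) + Real.exp (-(m * dZ y))) :=
      add_nonneg (mul_nonneg hK14 (mul_nonneg (by linarith only [hc0]) hX0)) (mul_nonneg hK23 hX0)
    calc ((((1 + rV * ((((L ^ kk : ℕ) : ℝ))⁻¹)) ^ ((d + 1) * L ^ kk) - 1) + ((Fintype.card ι : ℝ) + 1) * Real.exp (-(m * dZ y))) * (1 * 1 * (1 * B₆ * (1 * B₆ * τ * cr) * cr) * cr) +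
          (rV * (1 + Fintype.card (Fin (d + 1) ⊕ Fin (d + 1))) + aK a₀ (L : ℝ) kk * (Fintype.card ι * (Fintype.card ι * ((1 + rV * ((((L ^ kk : ℕ) : ℝ))⁻¹)) ^ ((d + 1) * L ^ kk) - 1) ^ 2 + 2 * ((1 + rV * ((((L ^ kk : ℕ) : ℝ))⁻¹)) ^ ((d + 1) * L ^ kk) - 1))) + (((L ^ mv : ℕ) : ℝ))⁻¹ + 1 * Real.exp (-(m * dZ y))) * (1 * τ * (1 * B₁ * (1 * B₆ * τ * cr) * cr) * cr) +
          (rV * (1 + Fintype.card (Fin (d + 1) ⊕ Fin (d + 1))) + aK a₀ (L : ℝ) kk * (Fintype.card ι * (Fintype.card ι * ((1 + rV * ((((L ^ kk : ℕ) : ℝ))⁻¹)) ^ ((d + 1) * L ^ kk) - 1) ^ 2 + 2 * ((1 + rV * ((((L ^ kk : ℕ) : ℝ))⁻¹)) ^ ((d + 1) * L ^ kk) - 1))) + (((L ^ mv : ℕ) : ℝ))⁻¹ + 1 * Real.exp (-(m * dZ y))) * (1 * τ * (1 * B₆ * (1 * B₁ * τ * cr) * cr) * cr) +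
          (((1 + rV * ((((L ^ kk : ℕ) : ℝ))⁻¹)) ^ ((d + 1) * L ^ kk) - 1) + ((Fintype.card ι : ℝ) + 1) * Real.exp (-(m * dZ y))) * (1 * τ * (1 * B₆ * (1 * B₆ * 1 * cr) * cr) * cr)) *
        Real.exp (-((δ₀ - 6 * m) * (unitTorusGeo L kk (cvM d L mv kk hL)).dist y y'))
        = ((K₁ + K₄) * (((1 + rV * ((((L ^ kk : ℕ) : ℝ))⁻¹)) ^ ((d + 1) * L ^ kk) - 1) + ((Fintype.card ι : ℝ) + 1) * Real.exp (-(m * dZ y))) + (K₂ + K₃) * (rV * (1 + Fintype.card (Fin (d + 1) ⊕ Fin (d + 1))) + aK a₀ (L : ℝ) kk * (Fintype.card ι * (Fintype.card ι * ((1 + rV * ((((L ^ kk : ℕ) : ℝ))⁻¹)) ^ ((d + 1) * L ^ kk) - 1) ^ 2 + 2 * ((1 + rV * ((((L ^ kk : ℕ) : ℝ))⁻¹)) ^ ((d + 1) * L ^ kk) - 1))) + (((L ^ mv : ℕ) : ℝ))⁻¹ + 1 * Real.exp (-(m * dZ y)))) *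
            Real.exp (-((δ₀ - 6 * m) * (unitTorusGeo L kk (cvM d L mv kk hL)).dist y y')) := by rw [hK₁, hK₂, hK₃, hK₄]; ring
      _ ≤ ((K₁ + K₄) * (((Fintype.card ι : ℝ) + 2) * (((1 + rV * ((((L ^ kk : ℕ) : ℝ))⁻¹)) ^ ((d + 1) * L ^ kk) - 1) + (rV * (1 + Fintype.card (Fin (d + 1) ⊕ Fin (d + 1))) + aK a₀ (L : ℝ) kk * (Fintype.card ι * (Fintype.card ι * ((1 + rV * ((((L ^ kk : ℕ) : ℝ))⁻¹)) ^ ((d + 1) * L ^ kk) - 1) ^ 2 + 2 * ((1 + rV * ((((L ^ kk : ℕ) : ℝ))⁻¹)) ^ ((d + 1) * L ^ kk) - 1))) + (((L ^ mv : ℕ) : ℝ))⁻¹) + Real.exp (-(m * dZ y)))) + (K₂ + K₃) * (((1 + rV * ((((L ^ kk : ℕ) : ℝ))⁻¹)) ^ ((d + 1) * L ^ kk) - 1) + (rV * (1 + Fintype.card (Fin (d + 1) ⊕ Fin (d + 1))) + aK a₀ (L : ℝ) kk * (Fintype.card ι * (Fintype.card ι * ((1 + rV * ((((L ^ kk : ℕ)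 : ℝ))⁻¹)) ^ ((d + 1) * L ^ kk) - 1) ^ 2 + 2 * ((1 + rV * ((((L ^ kk : ℕ) : ℝ))⁻¹)) ^ ((d + 1) * L ^ kk) - 1))) + (((L ^ mv : ℕ) : ℝ))⁻¹) + Real.exp (-(m * dZ y)))) *
            Real.exp (-(m * (unitTorusGeo L kk (cvM d L mv kk hL)).dist y y')) :=
          mul_le_mul (add_le_add (mul_le_mul_of_nonneg_left ha hK14) (mul_le_mul_of_nonneg_left hb hK23)) hexp (Real.exp_nonneg _) hmid0
      _ ≤ Bout * (rV * (1 + Fintype.card (Fin (d + 1) ⊕ Fin (d + 1))) + aK a₀ (L : ℝ) kk * (Fintype.card ι * (Fintype.card ι * ((1 + rV * ((((L ^ kk : ℕ) : ℝ))⁻¹)) ^ ((d + 1) * L ^ kk) - 1) ^ 2 + 2 * ((1 + rV * ((((L ^ kk : ℕ) : ℝ))⁻¹)) ^ ((d + 1) * L ^ kk) - 1))) + ((1 + rV * ((((L ^ kk : ℕ) : ℝ))⁻¹)) ^ ((d + 1) * L ^ kk) - 1) + (((L ^ mv : ℕ) : ℝ))⁻¹ + Real.exp (-(m * dZ y)))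 * Real.exp (-(m * (unitTorusGeo L kk (cvM d L mv kk hL)).dist y y')) := by
          refine mul_le_mul_of_nonneg_right ?_ (Real.exp_nonneg _)
          have e1 : Bout * (rV * (1 + Fintype.card (Fin (d + 1) ⊕ Fin (d + 1))) + aK a₀ (L : ℝ) kk * (Fintype.card ι * (Fintype.card ι * ((1 + rV * ((((L ^ kk : ℕ) : ℝ))⁻¹)) ^ ((d + 1) * L ^ kk) - 1) ^ 2 + 2 * ((1 + rV * ((((L ^ kk : ℕ) : ℝ))⁻¹)) ^ ((d + 1) * L ^ kk) - 1))) + ((1 + rV * ((((L ^ kk : ℕ) : ℝ))⁻¹)) ^ ((d + 1) * L ^ kk) - 1) + (((L ^ mv : ℕ) : ℝ))⁻¹ + Real.exp (-(m * dZ y))) =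
              ((K₁ + K₄) * (((Fintype.card ι : ℝ) + 2) * (((1 + rV * ((((L ^ kk : ℕ) : ℝ))⁻¹)) ^ ((d + 1) * L ^ kk) - 1) + (rV * (1 + Fintype.card (Fin (d + 1) ⊕ Fin (d + 1))) + aK a₀ (L : ℝ) kk * (Fintype.card ι * (Fintype.card ι * ((1 + rV * ((((L ^ kk : ℕ) : ℝ))⁻¹)) ^ ((d + 1) * L ^ kk) - 1) ^ 2 + 2 * ((1 + rV * ((((L ^ kk : ℕ) : ℝ))⁻¹)) ^ ((d + 1) * L ^ kk) - 1))) + (((L ^ mv : ℕ) : ℝ))⁻¹) + Real.exp (-(m * dZ y)))) + (K₂ + K₃) * (((1 + rV * ((((L ^ kk : ℕ) : ℝ))⁻¹)) ^ ((d + 1) * L ^ kk) - 1) + (rV * (1 + Fintype.card (Fin (d + 1) ⊕ Fin (d + 1))) + aK a₀ (L : ℝ) kk * (Fintype.card ι * (Fintype.card ι * ((1 + rV * ((((L ^ kk : ℕ) : ℝ))⁻¹)) ^ ((d + 1) * L ^ kk) - 1) ^ 2 + 2 * ((1 + rV * ((((L ^ kk : ℕ) : ℝ))⁻¹)) ^ ((d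 + 1) * L ^ kk) - 1))) + (((L ^ mv : ℕ) : ℝ))⁻¹) + Real.exp (-(m * dZ y)))) +
                1 * (((1 + rV * ((((L ^ kk : ℕ) : ℝ))⁻¹)) ^ ((d + 1) * L ^ kk) - 1) + (rV * (1 + Fintype.card (Fin (d + 1) ⊕ Fin (d + 1))) + aK a₀ (L : ℝ) kk * (Fintype.card ι * (Fintype.card ι * ((1 + rV * ((((L ^ kk : ℕ) : ℝ))⁻¹)) ^ ((d + 1) * L ^ kk) - 1) ^ 2 + 2 * ((1 + rV * ((((L ^ kk : ℕ) : ℝ))⁻¹)) ^ ((d + 1) * L ^ kk) - 1))) + (((L ^ mv : ℕ) : ℝ))⁻¹) + Real.exp (-(m * dZ y))) := by rw [hBout, hτdef]; ring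
          rw [e1]
          linarith only [hX0]
  exact hsop.mono fun y y' => hfin _ y y' rfl

end Green

end Summit.QuantumFields.YangMills.BalabanUVNodes.N15.Gluing

end
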